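import Literature.NumberTheory.Automorphic.PairLFunctionNeConjGlobalRankinSelbergTwisted

/-!
# The twisted global Rankin–Selberg theorem for a pair, with a general test function

Summit `Langlands`, sub-problem `Langlands`, helper file under `Theorems/` supporting the crux
`PairLBoundaryJS` (stmt-Langlands-13622, Arthur–Clozel (1989), Ch. 3, (2.2)), line `Sketch`,
skeleton v8: stub `stub_global_pair_twisted_gen`.

`stub_global_pair_twisted_gen` (**main**) is the tree theorem
`Literature.NumberTheory.Automorphic.exists_entire_eq_partialPairL_mul_setIntegral_pair_twisted`
(`PairLFunctionNeConjGlobalRankinSelbergTwisted`; Cogdell (2004), §2.3 p. 211, Thm. 2.1–2.2;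
Jacquet–Shalika (1981), §4) with ONE change: the frozen standard test function
`Φ = standardTestFun n K Φ_∞ = Φ_∞ ⊗ 𝟙_{𝒪̂ⁿ}` is replaced by an arbitrary real test function
`Φ : 𝔸_Kⁿ → ℝ` which is continuous, `≥ 0`, Schwartz–Bruhat, and spherical off `S'` only
(`IsLastRowSphericalAt n K Φ v` and support in the `v`-integral vectors at every `v ∉ S'`) — the shape
`Φ = Φ_∞ ⊗ Φ_{S'} ⊗ 𝟙^{S'}` of the printed method (Jacquet–Shalika (1981), (5.1); Cogdell (2004),
§2.3, §4.1), which leaves the local Schwartz–Bruhat data at the bad places `S'` free.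

Proof: verbatim the tree's. The three analytic inputs — the twisted unfolding on the strip
`exists_rankinSelbergIntegralTwisted_star_eq_mul_rankinSelbergTorusPairIntegralC`, the entire
continuation `exists_entire_eq_rankinSelbergIntegralTwisted` (the mirabolic Eisenstein series twisted
by `η ≠ 1` has no poles) and the finiteness
`rankinSelbergTorusIntegral_whittakerCoeff_ne_top_of_mem_piSchwartzBruhat` — are already stated for a
general Schwartz–Bruhat `Φ ≥ 0`; the final Euler factorisation is
`rankinSelbergTorusPairIntegralC_whittakerCoeff_eq_partialPairL_mul_of_spherical`, the general-`Φ`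
version of `rankinSelbergTorusPairIntegralC_whittakerCoeff_eq_partialPairL_mul`
(`RankinSelbergUnfoldedEulerCuspidalPairs`), obtained from the abstract factorisation
`rankinSelbergTorusPairIntegralC_eq_mul_setIntegral_of_hasProd`, which is stated for such `Φ`.

## References

* J. W. Cogdell, *Analytic theory of L-functions for GL_n*, in *An Introduction to the Langlands
  Program* (2004), §2.3 Thm. 2.1–2.2 and p. 211, §4.1–4.2 [CogdellAnalyticTheory2004].
* H. Jacquet, J. A. Shalika, *On Euler products and the classification of automorphic
  representations I*, Amer. J. Math. 103 (1981), §4, Lemma 4.2, (4.4)–(4.6), Thm. 4.8, (5.1)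
  [JacquetShalikaAJM1981].
* C. Mœglin, J.-L. Waldspurger, *Le spectre résiduel de GL(n)*, Ann. Sci. ÉNS 22 (1989), Appendice,
  Corollaire (i)(b), p. 667 [MoeglinWaldspurger1989].
-/

noncomputable section

-- `Summit.Langlands.Langlands.…` (summit = sub-problem name, D-0017 layout) trips `dupNamespace`
set_option linter.dupNamespace false

open scoped MatrixGroups Topology Pointwise ENNReal NNReal ComplexConjugate InnerProductSpace
open NumberField IsDedekindDomain MeasureTheory Measure Matrix Set Filter
open Literature.NumberTheory.Automorphic AdelicGroupData
open Literature.NumberTheory.GaloisRepresentations (ideleGroup HeckeCharacter localUnits)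
open Literature.RingTheory.SymmetricFunctions.SymmPoly

-- the automorphic quotient carries the tree's Borel σ-algebra, not Mathlib's quotient σ-algebra
attribute [-instance] Quotient.instMeasurableSpace QuotientGroup.measurableSpace

-- the house local instances, exactly as in `RankinSelbergUnfoldingIdentity`
attribute [local instance] adelicBorel borelSpace_adelic locallyCompactSpace_adelic secondCountableTopology_gl_adelic
  glAdeleBorel borelSpace_glAdele borelSpace_ideleGroup secondCountableTopology_ideleGroup

namespace Summit.Langlands.Langlands.Theorems.GlobalPairTwistedGen

open ValuativeRel

section Cuspidal

variable {n : ℕ} {K : Type} [Field K] [NumberField K]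
  {μ : Measure (AdelicGroupData.gl n K).automorphicQuotient} [(AdelicGroupData.gl n K).IsAutomorphicMeasure μ]
variable [MeasurableSpace ↥(adelicUnipotent n K)] [BorelSpace ↥(adelicUnipotent n K)]
  [MeasurableConstSMul ↥(rationalUnipotent n K) ↥(adelicUnipotent n K)]
  {ν : Measure ↥(adelicUnipotent n K)} [IsFiniteMeasureOnCompacts ν]
  [SMulInvariantMeasure ↥(rationalUnipotent n K) ↥(adelicUnipotent n K) ν] [ν.IsMulRightInvariant]
  {𝓕 : Set ↥(adelicUnipotent n K)} {ψ : AddChar (AdeleRing (𝓞 K) K) Circle}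
variable [MeasurableSpace (ideleGroup K)] [BorelSpace (ideleGroup K)]

/-- **`Ψ(s; W_φ, W̄_{φ'}, Φ) = L^{S'}(s, α ⊗ γ̄) · Ψ_{S'}(s)` on `re s > 1` for a general test function
`Φ ≥ 0` spherical off `S'`.** Let `π`, `π'` be cuspidal automorphic representations of `GL_n(𝔸_K)`
(`0 < n`) with Satake families `α`, `γ` off `S`, `f ∈ π`, `f' ∈ π'`, `η` a continuous compactly
supported left `K(𝔫₀)`-invariant weight, `W`, `W'` the global Whittaker coefficients of
`invQuot (S_η f)`, `invQuot (S_η f')`, and `S' ⊇ S` a set of finite places off which `v ∤ 𝔫₀` and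
`ψ_v` has conductor `𝒪_v`. Let `Φ : 𝔸_Kⁿ → ℝ`, `Φ ≥ 0`, with `g ↦ Φ(e_n g)` measurable, be spherical at
every `v ∉ S'`: invariant under the integral scalings at `v` on the `v`-integral vectors
(`IsLastRowSphericalAt`) and supported in the `v`-integral vectors. For `re s > 1`, if the two real
unfolded integrals `Ψ(re s; W, W̄, Φ)`, `Ψ(re s; W', W̄', Φ)` are finite, then
`Ψ(s; W, W̄', Φ) = partialPairL S' α γ̄ s · ∫_{B({v ∉ S'}) × K} W W̄' Φ(e_n ·) |det|^s δ_B⁻¹`.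
The tree's `rankinSelbergTorusPairIntegralC_whittakerCoeff_eq_partialPairL_mul` is the case
`Φ = Φ_∞ ⊗ 𝟙_{𝒪̂ⁿ}`; the proof is the same (Cogdell (2004), Thm. 2.2 with Thm. 3.3; Jacquet–Shalika
(1981), §4, (5.1) and Thm. (5.3), proof). -/
theorem rankinSelbergTorusPairIntegralC_whittakerCoeff_eq_partialPairL_mul_of_spherical (hn : 0 < n)
    (P Q : CuspidalAutomorphicRepGL n K μ) {S : Set (HeightOneSpectrum (𝓞 K))} {α γ : SatakeFamily K}
    (hα : IsSatakeFamilyOf P S α) (hγ : IsSatakeFamilyOf Q S γ) {𝔫₀ : Ideal (𝓞 K)} (h𝔫₀ : 𝔫₀ ≠ 0)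
    {η : (AdelicGroupData.gl n K).Adelic → ℝ} (hη : Continuous η) (hηs : HasCompactSupport η)
    (hηK : ∀ k : (AdelicGroupData.gl n K).Adelic, k ∈ principalCongruenceLevel n K 𝔫₀ →
      ∀ g : (AdelicGroupData.gl n K).Adelic, η (k * g) = η g)
    (f : P.1.toSubmodule) (f' : Q.1.toSubmodule)
    (h𝓕 : IsFundamentalDomain ↥(rationalUnipotent n K) 𝓕 ν) (h𝓕m : MeasurableSet 𝓕)
    (h𝓕c : IsCompact (closure 𝓕)) (hψ : IsGlobalAddChar K ψ)
    {S' : Set (HeightOneSpectrum (𝓞 K))} (hSS' : S ⊆ S')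
    (hGood : ∀ v ∉ S', ¬ v.asIdeal ∣ 𝔫₀ ∧ (∀ c ∈ 𝒪[v.adicCompletion K], ψ.adicComponent v c = 1) ∧
      ∀ ϖ : v.adicCompletion K, Valued.v ϖ = WithZero.exp (-1 : ℤ) →
        ∃ c ∈ 𝒪[v.adicCompletion K], ψ.adicComponent v (ϖ⁻¹ * c) ≠ 1)
    {x y : HeightOneSpectrum (𝓞 K) → Fin n → ℂ}
    (hx : ∀ v ∉ S', (Finset.univ : Finset (Fin n)).val.map (x v) = α v)
    (hy : ∀ v ∉ S', (Finset.univ : Finset (Fin n)).val.map (y v) = γ v)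
    {Φ : (Fin n → AdeleRing (𝓞 K) K) → ℝ} (hΦ0 : ∀ y, 0 ≤ Φ y)
    (hΦsph : ∀ v ∉ S', IsLastRowSphericalAt n K Φ v)
    (hΦv : ∀ v ∉ S', ∀ y : Fin n → AdeleRing (𝓞 K) K, Φ y ≠ 0 → ∀ j, Valued.v ((y j).2 v) ≤ 1)
    (hΦm : Measurable fun g : GL (Fin n) (AdeleRing (𝓞 K) K) => Φ (lastRow n K g))
    (νA : Measure (Fin n → ideleGroup K)) [νA.IsMulLeftInvariant] [SFinite νA]
    (νK : Measure ↥(maximalCompactAdelic n K)) [SFinite νK] {s : ℂ} (hs : 1 < s.re)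
    (hfin : rankinSelbergTorusIntegral n K νA νK
      (whittakerCoeff ν 𝓕 ψ
        (invQuot (AdelicGroupData.gl n K) (smoothedForm η (f : (AdelicGroupData.gl n K).L2 μ))))
      Φ s.re ≠ ⊤)
    (hfin' : rankinSelbergTorusIntegral n K νA νK
      (whittakerCoeff ν 𝓕 ψ
        (invQuot (AdelicGroupData.gl n K) (smoothedForm η (f' : (AdelicGroupData.gl n K).L2 μ))))
      Φ s.re ≠ ⊤) :
    rankinSelbergTorusPairIntegralC n K νA νK
        (whittakerCoeff ν 𝓕 ψ
          (invQuot (AdelicGroupData.gl n K) (smoothedForm η (f : (AdelicGroupData.gl n K).L2 μ))))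
        (star (whittakerCoeff ν 𝓕 ψ
          (invQuot (AdelicGroupData.gl n K) (smoothedForm η (f' : (AdelicGroupData.gl n K).L2 μ)))))
        Φ s =
      partialPairL S' α (fun v => (γ v).map conj) s *
        ∫ p in unitBox {v | v ∉ S'} ×ˢ Set.univ, torusPairIntegrandC n K
          (whittakerCoeff ν 𝓕 ψ
            (invQuot (AdelicGroupData.gl n K) (smoothedForm η (f : (AdelicGroupData.gl n K).L2 μ))))
          (star (whittakerCoeff ν 𝓕 ψ
            (invQuot (AdelicGroupData.gl n K) (smoothedForm η (f' : (AdelicGroupData.gl n K).L2 μ)))))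
          Φ s p ∂(νA.prod νK) := by
  classical
  set φ : GL (Fin n) (AdeleRing (𝓞 K) K) → ℂ :=
    invQuot (AdelicGroupData.gl n K) (smoothedForm η (f : (AdelicGroupData.gl n K).L2 μ)) with hφ
  set φ' : GL (Fin n) (AdeleRing (𝓞 K) K) → ℂ :=
    invQuot (AdelicGroupData.gl n K) (smoothedForm η (f' : (AdelicGroupData.gl n K).L2 μ)) with hφ'
  set W : GL (Fin n) (AdeleRing (𝓞 K) K) → ℂ := whittakerCoeff ν 𝓕 ψ φ with hWdef
  set W' : GL (Fin n) (AdeleRing (𝓞 K) K) → ℂ := whittakerCoeff ν 𝓕 ψ φ' with hW'def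
  have hGood' : ∀ v ∈ {v : HeightOneSpectrum (𝓞 K) | v ∉ S'}, v ∉ S ∧ ¬ v.asIdeal ∣ 𝔫₀ ∧
      (∀ c ∈ 𝒪[v.adicCompletion K], ψ.adicComponent v c = 1) ∧
      ∀ ϖ : v.adicCompletion K, Valued.v ϖ = WithZero.exp (-1 : ℤ) →
        ∃ c ∈ 𝒪[v.adicCompletion K], ψ.adicComponent v (ϖ⁻¹ * c) ≠ 1 :=
    fun v hv => ⟨fun h => hv (hSS' h), hGood v hv⟩
  -- the uniformizers of the Satake data of `π` at the good places, shared with `π'`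
  have hex : ∀ v ∉ S', ∃ ϖ : (v.adicCompletion K)ˣ, IsTorusUnramifiedAt n K W v ϖ (x v) := fun v hv =>
    exists_isTorusUnramifiedAt_whittakerCoeff_smoothedForm P hα h𝔫₀ (hGood' v hv).1 (hGood v hv).1
      hη hηs hηK f (hx v hv) h𝓕 h𝓕c hψ (hGood v hv).2.1 (hGood v hv).2.2
  have hex' : ∀ v ∉ S', ∃ ϖ : (v.adicCompletion K)ˣ, IsTorusUnramifiedAt n K W' v ϖ (y v) := fun v hv =>
    exists_isTorusUnramifiedAt_whittakerCoeff_smoothedForm Q hγ h𝔫₀ (hGood' v hv).1 (hGood v hv).1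
      hη hηs hηK f' (hy v hv) h𝓕 h𝓕c hψ (hGood v hv).2.1 (hGood v hv).2.2
  let ϖ : ∀ v : HeightOneSpectrum (𝓞 K), (v.adicCompletion K)ˣ := fun v =>
    if hv : v ∉ S' then Classical.choose (hex v hv) else 1
  have hW : ∀ v ∉ S', IsTorusUnramifiedAt n K W v (ϖ v) (x v) := fun v hv => by
    simp only [ϖ, dif_pos hv]
    exact Classical.choose_spec (hex v hv)
  have hW' : ∀ v ∉ S', IsTorusUnramifiedAt n K (star W') v (ϖ v) (star (y v)) := fun v hv => by
    obtain ⟨ϖ', hϖ'⟩ := hex' v hv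
    exact (hϖ'.of_valued_eq (hW v hv).valued_eq).star
  -- central invariance of `‖W‖`
  obtain ⟨ω, hu, -, -, -, -, hcl⟩ := P.exists_centralCharacter_smoothedForm
  have hWZ : ∀ (z : ideleGroup K) (g : GL (Fin n) (AdeleRing (𝓞 K) K)),
      ‖W (Matrix.GeneralLinearGroup.scalar (Fin n) z * g)‖ = ‖W g‖ := fun z g => by
    rw [hWdef, whittakerCoeff_scalar_mul (fun g' => hcl η f z g') g, norm_mul, hu z, one_mul]
  -- integrability of the complex pair integrand
  have hWc : Continuous W := continuous_whittakerCoeff h𝓕m h𝓕c hψ.continuous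
    (continuous_invQuot_smoothedForm hη hηs _)
  have hW'c : Continuous W' := continuous_whittakerCoeff h𝓕m h𝓕c hψ.continuous
    (continuous_invQuot_smoothedForm hη hηs _)
  have hW'sc : Continuous (star W') := hW'c.star
  haveI : SecondCountableTopology (GL (Fin n) (AdeleRing (𝓞 K) K)) :=
    secondCountableTopology_generalLinearGroup_adeleRing K (Fin n)
  haveI : SecondCountableTopology (AdelicGroupData.gl n K).Adelic :=
    secondCountableTopology_generalLinearGroup_adeleRing K (Fin n)
  haveI : SecondCountableTopology ↥(maximalCompactAdelic n K) := TopologicalSpace.Subtype.secondCountableTopology _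
  have hpt : Measurable (torusPoint n K) := continuous_torusPoint.measurable
  have hmeas : Measurable (torusPairIntegrandC n K W (star W') Φ s) :=
    measurable_torusPairIntegrandC (hWc.measurable.comp hpt) (hW'sc.measurable.comp hpt) (hΦm.comp hpt) s
  have hfin'' : rankinSelbergTorusIntegral n K νA νK (star W') Φ s.re ≠ ⊤ := by
    rw [rankinSelbergTorusIntegral_star]; exact hfin'
  have hint : Integrable (torusPairIntegrandC n K W (star W') Φ s) (νA.prod νK) :=
    integrable_torusPairIntegrandC νA νK hΦ0 hmeas.aestronglyMeasurable (measurable_torusIntegrand hWc hΦm s.re)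
      (measurable_torusIntegrand hW'sc hΦm s.re) hfin hfin''
  -- finiteness of the real torus sums at `re s` from the Satake bound
  have hy' : ∀ v ∉ S', (Finset.univ : Finset (Fin n)).val.map (star (y v)) = (γ v).map conj := fun v hv => by
    rw [← hy v hv, Multiset.map_map]
    rfl
  have hTx : ∀ v ∉ S', schurSelfSum (x v) ((v.residueCard : ℝ) ^ (-s.re)) ≠ ⊤ := fun v hv =>
    schurSelfSum_ne_top_of_norm_satakeParameter_le_sqrt norm_satakeParameter_le_sqrt_holds P hα
      (hGood' v hv).1 (x v) (hx v hv) hs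
  have hTy : ∀ v ∉ S', schurSelfSum (star (y v)) ((v.residueCard : ℝ) ^ (-s.re)) ≠ ⊤ := fun v hv =>
    schurSelfSum_ne_top_of_norm_satakeParameter_le_sqrt norm_satakeParameter_le_sqrt_holds Q.conj hγ.conj
      (hGood' v hv).1 (star (y v)) (hy' v hv) hs
  -- the Euler product of the local factors
  have hL := hasProd_partialPairL JacquetShalika1981_multipliable_partialPairL_holds P Q.conj (hα.mono hSS')
    (hγ.mono hSS').conj hs
  exact rankinSelbergTorusPairIntegralC_eq_mul_setIntegral_of_hasProd νA νK hn hW hW' hWZ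
    hΦsph hΦv hΦ0 hint hTx hTy hx hy' hL

end Cuspidal

/-- **The global half of Mœglin–Waldspurger's Corollaire (i)(b) for pairs with `ω_π ω_{π'}⁻¹ ≠ 1`,
general test function.** There is a constant `C > 0`, depending only on the Haar measures, such that
for all cuspidal automorphic representations `π`, `π'` of `GL_n(𝔸_K)` (`0 < n`) with Satake families
`α`, `γ` off `S`, whose smoothed forms transform under the centre through unitary `ω⁻¹`, `ω'⁻¹` with
`χ = ω ω'⁻¹ ≠ 1` trivial on `A_G`, all `f ∈ π`, `f' ∈ π'`, every ideal `𝔫₀ ≠ 0` and test function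
`θ` left invariant under `K(𝔫₀)`, every set of finite places `S' ⊇ S` off which `v ∤ 𝔫₀` and
`v ∤ 𝔡_{K/ℚ}`, all enumerations `x`, `y` of `α`, `γ` off `S'`, and every real test function
`Φ : 𝔸_Kⁿ → ℝ` which is continuous, `≥ 0`, Schwartz–Bruhat and spherical off `S'`
(`IsLastRowSphericalAt` and supported in the `v`-integral vectors at every `v ∉ S'`), there is an
**entire** function `F` with

* `F(s) = I_χ(s; S̄_θ f', S_θ f, Φ)` for `re s > 1` (`exists_entire_eq_rankinSelbergIntegralTwisted`:
  the twisted Eisenstein series has no poles, Jacquet–Shalika (1981), Lemma 4.2);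
* `F(s) = C · partialPairL S' α γ̄ s · ∫_{B({v ∉ S'}) × K} W_φ W̄_{φ'} Φ(e_n ·) |det|^s δ_B⁻¹` for
  `1 < re s < 2` — unfolding on the strip
  (`exists_rankinSelbergIntegralTwisted_star_eq_mul_rankinSelbergTorusPairIntegralC`) and the Euler
  factorisation of the pair for a test function spherical off `S'`
  (`rankinSelbergTorusPairIntegralC_whittakerCoeff_eq_partialPairL_mul_of_spherical`) for Tate's
  character (conductor `𝒪_v` off `𝔡`).

The tree's `exists_entire_eq_partialPairL_mul_setIntegral_pair_twisted`
(`PairLFunctionNeConjGlobalRankinSelbergTwisted`) is the case `Φ = Φ_∞ ⊗ 𝟙_{𝒪̂ⁿ}`; the proof is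
verbatim the same. Cogdell (2004), Thm. 2.1–2.2 with §2.3 p. 211, §4.1; Jacquet–Shalika (1981), §4,
(5.1); Mœglin–Waldspurger (1989), Appendice, Cor. (i)(b) for `ω_π ω̄_σ ≠ 1`. -/
theorem stub_global_pair_twisted_gen :
    ∀ {n : ℕ} {K : Type} [Field K] [NumberField K]
      [MeasurableSpace (AdeleRing (𝓞 K) K)] [BorelSpace (AdeleRing (𝓞 K) K)] (_hn : 0 < n)
      (μ' : Measure (AdelicGroupData.gl n K).automorphicQuotient)
      [(AdelicGroupData.gl n K).IsAutomorphicMeasure μ']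
      (νI : Measure (ideleGroup K)) [νI.IsHaarMeasure]
      (νA : Measure (Fin n → ideleGroup K)) [IsHaarMeasure νA]
      (νK : Measure ↥(maximalCompactAdelic n K)) [IsHaarMeasure νK]
      (ν₀ : Measure ↥(adelicUnipotent n K)) [IsHaarMeasure ν₀],
      ∃ C : ℝ, 0 < C ∧
      ∀ (P Q : CuspidalAutomorphicRepGL n K μ') (f : P.1.toSubmodule) (f' : Q.1.toSubmodule)
      {ω ω' χ : HeckeCharacter K}, ω.IsUnitary → ω'.IsUnitary → χ = ω * ω'⁻¹ → χ ≠ 1 →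
      ∀ (hχ₀ : ∀ t : ℝ≥0ˣ, χ (posRealIdele K t) = 1)
      {S : Set (HeightOneSpectrum (𝓞 K))} {α γ : SatakeFamily K}, IsSatakeFamilyOf P S α →
      IsSatakeFamilyOf Q S γ →
      ∀ {𝔫₀ : Ideal (𝓞 K)}, 𝔫₀ ≠ 0 →
      ∀ {θ : (AdelicGroupData.gl n K).Adelic → ℝ}, IsTestFunctionGL n K θ →
      (∀ k : (AdelicGroupData.gl n K).Adelic, k ∈ principalCongruenceLevel n K 𝔫₀ →
      ∀ g : (AdelicGroupData.gl n K).Adelic, θ (k * g) = θ g) →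
      (∀ (z : ideleGroup K) (g : GL (Fin n) (AdeleRing (𝓞 K) K)),
      smoothedForm θ (f : (AdelicGroupData.gl n K).L2 μ')
      ((AdelicGroupData.gl n K).toAutomorphicQuotient (Matrix.GeneralLinearGroup.scalar (Fin n) z * g)) =
      ((ω z : ℂˣ) : ℂ)⁻¹ * smoothedForm θ (f : (AdelicGroupData.gl n K).L2 μ')
      ((AdelicGroupData.gl n K).toAutomorphicQuotient g)) →
      (∀ (z : ideleGroup K) (g : GL (Fin n) (AdeleRing (𝓞 K) K)),
      smoothedForm θ (f' : (AdelicGroupData.gl n K).L2 μ')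
      ((AdelicGroupData.gl n K).toAutomorphicQuotient (Matrix.GeneralLinearGroup.scalar (Fin n) z * g)) =
      ((ω' z : ℂˣ) : ℂ)⁻¹ * smoothedForm θ (f' : (AdelicGroupData.gl n K).L2 μ')
      ((AdelicGroupData.gl n K).toAutomorphicQuotient g)) →
      ∀ {S' : Set (HeightOneSpectrum (𝓞 K))}, S ⊆ S' →
      (∀ v ∉ S', ¬ v.asIdeal ∣ 𝔫₀ ∧ ¬ v.asIdeal ∣ differentIdeal ℤ (𝓞 K)) →
      ∀ {x y : HeightOneSpectrum (𝓞 K) → Fin n → ℂ},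
      (∀ v ∉ S', (Finset.univ : Finset (Fin n)).val.map (x v) = α v) →
      (∀ v ∉ S', (Finset.univ : Finset (Fin n)).val.map (y v) = γ v) →
      ∀ {Φ : (Fin n → AdeleRing (𝓞 K) K) → ℝ}, Continuous Φ → (∀ y, 0 ≤ Φ y) →
      (fun y => ((Φ y : ℝ) : ℂ)) ∈ piSchwartzBruhat K (Fin n) →
      (∀ v ∉ S', IsLastRowSphericalAt n K Φ v) →
      (∀ v ∉ S', ∀ y : Fin n → AdeleRing (𝓞 K) K, Φ y ≠ 0 → ∀ j, Valued.v ((y j).2 v) ≤ 1) →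
      ∃ F : ℂ → ℂ, Differentiable ℂ F ∧
      (∀ s : ℂ, 1 < s.re → F s =
      rankinSelbergIntegralTwisted μ' νI hχ₀ (fun y => ((Φ y : ℝ) : ℂ)) s
      (star (smoothedForm θ (f' : (AdelicGroupData.gl n K).L2 μ')))
      (smoothedForm θ (f : (AdelicGroupData.gl n K).L2 μ'))) ∧
      (∀ s : ℂ, 1 < s.re → s.re < 2 → F s = (C : ℂ) *
      (partialPairL S' α (fun v => (γ v).map conj) s *
      ∫ p in unitBox {v | v ∉ S'} ×ˢ Set.univ, torusPairIntegrandC n K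
      (whittakerCoeff ν₀ (unipotentTateDomain n K) (adeleAddChar K)
      (invQuot (AdelicGroupData.gl n K) (smoothedForm θ (f : (AdelicGroupData.gl n K).L2 μ'))))
      (star (whittakerCoeff ν₀ (unipotentTateDomain n K) (adeleAddChar K)
      (invQuot (AdelicGroupData.gl n K) (smoothedForm θ (f' : (AdelicGroupData.gl n K).L2 μ')))))
      Φ s p ∂(νA.prod νK))) := by
  intro n K _ _ _ _ hn μ' _ νI _ νA _ νK _ ν₀ _
  classical
  haveI : T2Space (GL (Fin n) (AdeleRing (𝓞 K) K)) := t2Space_gl n K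
  haveI : LocallyCompactSpace (GL (Fin n) (AdeleRing (𝓞 K) K)) :=
    AdelicGroupData.locallyCompactSpace_generalLinearGroup_adeleRing K (Fin n)
  haveI : SecondCountableTopology (GL (Fin n) (AdeleRing (𝓞 K) K)) :=
    secondCountableTopology_generalLinearGroup_adeleRing K (Fin n)
  haveI hν₀R : ν₀.IsMulRightInvariant := isMulRightInvariant_of_isHaarMeasure_adelicUnipotent ν₀
  haveI hνIR : νI.IsMulRightInvariant := by
    haveI := isInvInvariant_of_isHaarMeasure_ideleGroup (K := K) νI
    infer_instance
  haveI := locallyCompactSpace_ideleGroup K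
  haveI : CompactSpace ↥(maximalCompactAdelic n K) :=
    isCompact_iff_compactSpace.1 (isCompact_maximalCompactAdelic n K)
  obtain ⟨C, hC, hunf⟩ :=
    exists_rankinSelbergIntegralTwisted_star_eq_mul_rankinSelbergTorusPairIntegralC (n := n) (K := K) hn μ' νI νA νK ν₀
  refine ⟨C, hC, fun P Q f f' {ω ω' χ} hωu hω'u hχeq hχ1 hχ₀ {S} {α} {γ} hα hγ {𝔫₀} h𝔫₀ {θ} hθ hθK hωf hω'f'
    {S'} hSS' hS' {x} {y} hx hy {Φ} hΦc hΦ0 hΦS hΦsph hΦv => ?_⟩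
  -- the test function: `g ↦ Φ(e_n g)` is measurable
  have hΦm : Measurable fun g : GL (Fin n) (AdeleRing (𝓞 K) K) => Φ (lastRow n K g) :=
    (hΦc.comp continuous_lastRow).measurable
  -- the twisting character is unitary and non-trivial on `𝕀_K¹`
  have hχu : χ.IsUnitary := by
    intro a
    rw [hχeq, HeckeCharacter.mul_apply, HeckeCharacter.inv_apply, Units.val_mul, Units.val_inv_eq_inv_val,
      norm_mul, norm_inv, hωu a, hω'u a, inv_one, mul_one]
  have hχb : ∃ b : ideleGroup K, IdeleClassGroup.ideleNorm K b = 1 ∧ χ b ≠ 1 :=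
    χ.exists_ideleNorm_eq_one_and_ne_one_of_map_posRealIdele hχ₀ hχ1
  -- the entire continuation of `I_χ`
  have hφtc : Continuous (smoothedForm θ (f : (AdelicGroupData.gl n K).L2 μ')) :=
    continuous_smoothedForm hθ.continuous hθ.hasCompactSupport _
  have hφt'c : Continuous (smoothedForm θ (f' : (AdelicGroupData.gl n K).L2 μ')) :=
    continuous_smoothedForm hθ.continuous hθ.hasCompactSupport _
  have hφd : IsRapidlyDecreasingGL n K (invQuot (AdelicGroupData.gl n K) (smoothedForm θ (f : (AdelicGroupData.gl n K).L2 μ'))) :=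
    isRapidlyDecreasingGL_invQuot_smoothedForm hθ (P.2.1 f.2)
  have hφ'd : IsRapidlyDecreasingGL n K (invQuot (AdelicGroupData.gl n K)
      (star (smoothedForm θ (f' : (AdelicGroupData.gl n K).L2 μ')))) :=
    isRapidlyDecreasingGL_invQuot_star (isRapidlyDecreasingGL_invQuot_smoothedForm hθ (Q.2.1 f'.2))
  obtain ⟨F, hF, hFI⟩ := exists_entire_eq_rankinSelbergIntegralTwisted (K := K) νI hn μ' hχu hχb hχ₀ hΦS
    (show Continuous (star (smoothedForm θ (f' : (AdelicGroupData.gl n K).L2 μ'))) from continuous_star.comp hφt'c)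
    hφtc hφ'd hφd
  refine ⟨F, hF, hFI, fun s hs1 hs2 => ?_⟩
  -- Tate's character and fundamental domain
  have hψ : IsGlobalAddChar K (adeleAddChar K) := isGlobalAddChar_adeleAddChar (K := K)
  have h𝓕 : IsFundamentalDomain ↥(rationalUnipotent n K) (unipotentTateDomain n K) ν₀ :=
    isFundamentalDomain_unipotentTateDomain ν₀
  have h𝓕c : IsCompact (closure (unipotentTateDomain n K)) := isCompact_closure_unipotentTateDomain
  have h𝓕m : MeasurableSet (unipotentTateDomain n K) := measurableSet_unipotentTateDomain
  have hGood : ∀ v ∉ S', ¬ v.asIdeal ∣ 𝔫₀ ∧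
      (∀ c ∈ 𝒪[v.adicCompletion K], (adeleAddChar K).adicComponent v c = 1) ∧
      ∀ ϖ : v.adicCompletion K, Valued.v ϖ = WithZero.exp (-1 : ℤ) →
        ∃ c ∈ 𝒪[v.adicCompletion K], (adeleAddChar K).adicComponent v (ϖ⁻¹ * c) ≠ 1 := fun v hv =>
    ⟨(hS' v hv).1, (adicComponent_adeleAddChar_unramified (K := K) (hS' v hv).2).1,
      (adicComponent_adeleAddChar_unramified (K := K) (hS' v hv).2).2⟩
  -- finiteness of the two real unfolded integrals at `re s`
  have hfin : rankinSelbergTorusIntegral n K νA νK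
      (whittakerCoeff ν₀ (unipotentTateDomain n K) (adeleAddChar K)
        (invQuot (AdelicGroupData.gl n K) (smoothedForm θ (f : (AdelicGroupData.gl n K).L2 μ')))) Φ s.re ≠ ⊤ :=
    rankinSelbergTorusIntegral_whittakerCoeff_ne_top_of_mem_piSchwartzBruhat hn νA νK ν₀ P f hθ hΦS hΦ0 hΦm hs1
  have hfin' : rankinSelbergTorusIntegral n K νA νK
      (whittakerCoeff ν₀ (unipotentTateDomain n K) (adeleAddChar K)
        (invQuot (AdelicGroupData.gl n K) (smoothedForm θ (f' : (AdelicGroupData.gl n K).L2 μ')))) Φ s.re ≠ ⊤ :=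
    rankinSelbergTorusIntegral_whittakerCoeff_ne_top_of_mem_piSchwartzBruhat hn νA νK ν₀ Q f' hθ hΦS hΦ0 hΦm hs1
  -- unfold on the strip and factor
  rw [hFI s hs1, hunf P Q f f' hωu hω'u hχeq hχ1 hχ₀ hθ hωf hω'f' hΦS hΦ0 hΦm hs1 hs2,
    rankinSelbergTorusPairIntegralC_whittakerCoeff_eq_partialPairL_mul_of_spherical hn P Q hα hγ h𝔫₀ hθ.continuous
      hθ.hasCompactSupport hθK f f' h𝓕 h𝓕m h𝓕c hψ hSS' hGood hx hy hΦ0 hΦsph hΦv hΦm νA νK hs1 hfin hfin']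

end Summit.Langlands.Langlands.Theorems.GlobalPairTwistedGen

end
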